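import Literature.MathematicalPhysics.QuantumLattice.HubbardCovarianceCTNormalForm
import Literature.MathematicalPhysics.QuantumLattice.HubbardSectorPhaseSpaceCount
import Literature.MathematicalPhysics.QuantumLattice.SliceCutoffGramConstant
import Literature.MathematicalPhysics.QuantumLattice.GrassmannDeterminantBounded
import HarnessLib

/-!
# The Gram constant of ONE slice of the counterterm-frame covariance: `‖F_Y‖², ‖G_Y‖² ≲ Λ′²/Λ` per `(βL²)`, sector-free
# (Benfatto–Giuliani–Mastropietro 2006, (2.80), for the frames `e_K = ε − μ − K` given a density-of-states count)

Topic `MathematicalPhysics/QuantumLattice`; the counterterm-frame twin of `HubbardShiftedSliceGram.norm_sq_sectorGramF_shiftedSlice_le`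
(FREE band, shifted frequencies, counted by `TorusShellCounting.card_torusShell_le`).  The single-slice covariance the multiscale expansion of
a Wilsonian flow with counterterm `K` integrates, `C^K_{(Λ,Λ′]} = C^K_{>Λ} − C^K_{>Λ′}` (`hubbardCovSliceCT`), is NORMAL at seed `0` with
symbol `p^K_{Λ,Λ′}(k,σ) = (w^K_Λ(k) − w^K_{Λ′}(k))·βL²·(iω + e_K)/(ω² + e_K²)` (`HubbardCovarianceCTNormalForm.hubbardCovSliceCT_zero_seed`),
so the Gram machinery of `HubbardSectorPropagatorGram` / `HubbardSectorPhaseSpaceCount` (`sectorGramF/G`, `norm_sq_sectorGramF_le`: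
Gram constant = sup of the symbol × phase-space count of its support) applies verbatim.  PROVED here, for an ARBITRARY frame `K` and
chemical potential `μ`, GIVEN the level count `#{k⃗ : |e_K(k⃗)| < Λ′} ≤ c₁Λ′L² + c₂L` (supplied for every admissible frame of the cell
gate-hubbard-kl's programme by `Theorems/KLProgrammeKLRegimeFrameShellCount.card_frameLevel_lt_le`, `(c₁, c₂) = (1793, 704)`, all `L ≥ 1`):

* `nambuDenCT_zero_seed` — `den_K(k) = ω² + e_K²` at seed `0` (so `‖(iω + e_K)/den_K‖ = 1/√(ω² + e_K²)`);
* `norm_sliceSymbolCT_le` — **sup**: on the shell `Λ²/4 < ω² + e_K² < Λ′²` (else the symbol vanishes) `‖p^K_{Λ,Λ′}‖ ≤ 2βL²/Λ`;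
* `card_shellSupportCT_le` — **count**: `#{(i,k⃗) : |ω_i| ≤ Λ′, |e_K(k⃗)| < Λ′} ≤ (Λ′β/π + 3)·(c₁Λ′L² + c₂L)`;
* **`norm_sq_sectorGramF_sliceCT_le`**, **`norm_sq_sectorGramG_sliceCT_le`** — for multipliers `‖F_ω(k)‖ ≤ 1`, `0 < β`, `0 < Λ ≤ Λ′`
  (no sign condition on `c₁, c₂`: the count hypothesis carries it):
  `‖F_Y‖², ‖G_Y‖² ≤ ‖(βL²)⁻¹‖² · [(Λ′β/π + 3)·(c₁Λ′L² + c₂L)] · (2βL²/Λ)` — at `Λ′ = 4Λ = Λ_n`, `β, L ≳ 1/Λ`: `≲ Λ_n/(βL²)·βL²·… ≍ Λ_n`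
  relative to the field normalisation, the single-scale power-counting factor, uniformly in the frame and in `M`;
* **`isGramBoundedR_sectorSub_sliceCT`** (appended) — hence `IsGramBoundedR (Sᵀ·C^K_{(Λ,Λ′]}·S) κ`, `κ² =` the bound above, for the
  sectorised slice `S = sectorSubMatrix L M β F` — the literal covariance hypothesis of the single-scale step
  `GrassmannEffectiveActionBoundDB.sum_norm_kernel_effAction_le_of_gramBounded` (Gram form + charge, `isGramBoundedR_of_gram`).

Everything is PROVED; no definition, no named fact.

## References

* G. Benfatto, A. Giuliani, V. Mastropietro, Ann. Henri Poincaré 7 (2006) 809–898, §2.1 (2.3), §2.5 (2.50), §2.8 (2.80), footnote 1.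
  [BenfattoGiulianiMastropietro2006]
* M. Salmhofer, *Renormalization* (Springer 1999), §4.2.5 (4.70)–(4.71). [Salmhofer1999]
-/

noncomputable section

namespace Literature.MathematicalPhysics.QuantumLattice

open Finset Literature.Probability.LatticeModels GrassmannAlgebra

variable {L M : ℕ}

/-! ### The slice symbol of the frame covariance and its sup -/

/-- At seed `0` the CT denominator is `ω² + e_K²`. [cite: BenfattoGiulianiMastropietro2006, §2.1 (2.3)] -/
theorem nambuDenCT_zero_seed (β μ : ℝ) (K : TrigPolyC4v) (k : FreqMomentum L M) :
    nambuDenCT L M β μ 0 K k = matsubaraFreq β M k.1 ^ 2 + nambuXiCT L μ K k.2 ^ 2 := by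
  simp [nambuDenCT]

/-- `‖(iω + e)/(ω² + e²)‖ = 1/√(ω² + e²)` (also at `ω = e = 0`, where both sides vanish). [folklore] -/
private theorem norm_I_mul_add_div (ω ξ : ℝ) :
    ‖(Complex.I * (ω : ℂ) + (ξ : ℂ)) / (((ω ^ 2 + ξ ^ 2 : ℝ)) : ℂ)‖ = 1 / Real.sqrt (ω ^ 2 + ξ ^ 2) := by
  have hnum : ‖Complex.I * (ω : ℂ) + (ξ : ℂ)‖ = Real.sqrt (ω ^ 2 + ξ ^ 2) := by
    rw [Complex.norm_eq_sqrt_sq_add_sq]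
    congr 1
    simp [Complex.add_re, Complex.add_im, Complex.mul_re, Complex.mul_im]
    ring
  rw [norm_div, hnum, Complex.norm_real, Real.norm_eq_abs, abs_of_nonneg (by positivity)]
  by_cases h0 : ω ^ 2 + ξ ^ 2 = 0
  · rw [h0, Real.sqrt_zero]; simp
  · have hpos : 0 < ω ^ 2 + ξ ^ 2 := lt_of_le_of_ne (by positivity) (Ne.symm h0)
    rw [div_eq_div_iff (by positivity) (Real.sqrt_pos.2 hpos).ne', one_mul, Real.mul_self_sqrt hpos.le]

/-- **The sup of the slice symbol of the frame covariance.**  For `0 < β`, `0 < Λ ≤ Λ′`, every frame `K`, `μ`, and every label: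
`‖(w^K_Λ − w^K_{Λ′})·βL²·(iω + e_K)/den_K‖ ≤ 2βL²/Λ` (the slice weight lives on `Λ²/4 < ω² + e_K²`, where `1/√(ω² + e_K²) < 2/Λ`).
[cite: BenfattoGiulianiMastropietro2006, §2.5 (2.50)] -/
theorem norm_sliceSymbolCT_le [NeZero L] {β : ℝ} (hβ : 0 < β) (μ : ℝ) (K : TrigPolyC4v) {Λ Λ' : ℝ} (hΛ : 0 < Λ)
    (hΛΛ' : Λ ≤ Λ') (ks : FreqMomentum L M × Fin 2) :
    ‖((hubbardCutoffWeightCT L M β μ K Λ ks.1 : ℂ) - (hubbardCutoffWeightCT L M β μ K Λ' ks.1 : ℂ)) *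
        (((β * (L : ℝ) ^ 2 : ℝ) : ℂ) *
          ((Complex.I * matsubaraFreq β M ks.1.1 + nambuXiCT L μ K ks.1.2) / nambuDenCT L M β μ 0 K ks.1))‖ ≤
      2 * (β * (L : ℝ) ^ 2) / Λ := by
  set ω : ℝ := matsubaraFreq β M ks.1.1 with hω
  set ξ : ℝ := nambuXiCT L μ K ks.1.2 with hξ
  have hwdef : hubbardCutoffWeightCT L M β μ K Λ ks.1 - hubbardCutoffWeightCT L M β μ K Λ' ks.1 =
      salmhoferCutoff ((ω ^ 2 + ξ ^ 2) / Λ ^ 2) - salmhoferCutoff ((ω ^ 2 + ξ ^ 2) / Λ' ^ 2) := by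
    simp only [hubbardCutoffWeightCT, hω, hξ]
  by_cases h0 : hubbardCutoffWeightCT L M β μ K Λ ks.1 - hubbardCutoffWeightCT L M β μ K Λ' ks.1 = 0
  · have : ((hubbardCutoffWeightCT L M β μ K Λ ks.1 : ℂ) - (hubbardCutoffWeightCT L M β μ K Λ' ks.1 : ℂ)) = 0 := by
      exact_mod_cast h0
    rw [this, zero_mul, norm_zero]
    positivity
  · rw [hwdef] at h0
    obtain ⟨hlow, -⟩ := support_sliceCutoff hΛ hΛΛ' h0
    have hw : ‖((hubbardCutoffWeightCT L M β μ K Λ ks.1 : ℂ) - (hubbardCutoffWeightCT L M β μ K Λ' ks.1 : ℂ))‖ ≤ 1 := by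
      rw [← Complex.ofReal_sub, Complex.norm_real, Real.norm_eq_abs, hwdef]
      exact abs_sliceCutoff_le_one _ Λ Λ'
    have hden : (nambuDenCT L M β μ 0 K ks.1 : ℝ) = ω ^ 2 + ξ ^ 2 := by rw [nambuDenCT_zero_seed]
    have hsym : ‖(Complex.I * (ω : ℂ) + (ξ : ℂ)) / ((nambuDenCT L M β μ 0 K ks.1 : ℝ) : ℂ)‖ = 1 / Real.sqrt (ω ^ 2 + ξ ^ 2) := by
      rw [hden]; exact norm_I_mul_add_div ω ξ
    have hsqrt : Λ / 2 ≤ Real.sqrt (ω ^ 2 + ξ ^ 2) := by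
      rw [show Λ / 2 = Real.sqrt ((Λ / 2) ^ 2) by rw [Real.sqrt_sq (by positivity)]]
      exact Real.sqrt_le_sqrt (by linarith)
    have hs0 : 0 < Real.sqrt (ω ^ 2 + ξ ^ 2) := lt_of_lt_of_le (by positivity) hsqrt
    have hinv : 1 / Real.sqrt (ω ^ 2 + ξ ^ 2) ≤ 2 / Λ := by
      rw [div_le_div_iff₀ hs0 hΛ]; linarith
    have hβL : ‖(((β * (L : ℝ) ^ 2 : ℝ)) : ℂ)‖ = β * (L : ℝ) ^ 2 := by
      rw [Complex.norm_real, Real.norm_eq_abs, abs_of_nonneg (by positivity)]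
    calc ‖((hubbardCutoffWeightCT L M β μ K Λ ks.1 : ℂ) - (hubbardCutoffWeightCT L M β μ K Λ' ks.1 : ℂ)) *
            (((β * (L : ℝ) ^ 2 : ℝ) : ℂ) * ((Complex.I * (ω : ℂ) + (ξ : ℂ)) / ((nambuDenCT L M β μ 0 K ks.1 : ℝ) : ℂ)))‖
        = ‖((hubbardCutoffWeightCT L M β μ K Λ ks.1 : ℂ) - (hubbardCutoffWeightCT L M β μ K Λ' ks.1 : ℂ))‖ *
            ((β * (L : ℝ) ^ 2) * (1 / Real.sqrt (ω ^ 2 + ξ ^ 2))) := by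
          rw [norm_mul, norm_mul, hβL, hsym]
      _ ≤ 1 * ((β * (L : ℝ) ^ 2) * (2 / Λ)) := by
          refine mul_le_mul hw (mul_le_mul_of_nonneg_left hinv (by positivity)) (by positivity) zero_le_one
      _ = 2 * (β * (L : ℝ) ^ 2) / Λ := by ring

/-! ### The phase-space count of the slice support -/

/-- **The phase-space count of the shell** `{|ω| ≤ Λ′} × {|e_K(k⃗)| < Λ′}` given the level count of the frame band:
`≤ (Λ′β/π + 3)·(c₁Λ′L² + c₂L)` (the Matsubara count `card_filter_matsubaraFreq_le` times the level count).
[cite: BenfattoGiulianiMastropietro2006, §2.8 (2.80)] -/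
theorem card_shellSupportCT_le [NeZero L] {β : ℝ} (hβ : 0 < β) (μ : ℝ) (K : TrigPolyC4v) {Λ' c₁ c₂ : ℝ} (hΛ' : 0 < Λ')
    (hcount : (((univ : Finset (TorusSite 2 L)).filter fun k => |nambuXiCT L μ K k| < Λ').card : ℝ) ≤
      c₁ * Λ' * (L : ℝ) ^ 2 + c₂ * L) :
    ((((univ : Finset (FreqMomentum L M)).filter fun k =>
        |matsubaraFreq β M k.1| ≤ Λ' ∧ |nambuXiCT L μ K k.2| < Λ').card : ℕ) : ℝ) ≤
      (Λ' * β / Real.pi + 3) * (c₁ * Λ' * (L : ℝ) ^ 2 + c₂ * L) := by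
  classical
  have hL : (0 : ℝ) ≤ L := Nat.cast_nonneg L
  rw [card_filter_freqMomentum_eq (fun i : MatsubaraIdx M => |matsubaraFreq β M i| ≤ Λ')
    (fun k : TorusSite 2 L => |nambuXiCT L μ K k| < Λ'), Nat.cast_mul]
  exact mul_le_mul (card_filter_matsubaraFreq_le hβ hΛ'.le _ fun i hi => (mem_filter.1 hi).2) hcount
    (Nat.cast_nonneg _) (by positivity)

/-! ### The Gram constants of the slice -/

/-- **The Gram constant of one slice of the frame covariance (left vector), sector-free** (BGM 2006 (2.80)): for multipliers
`‖F_ω(k)‖ ≤ 1`, `0 < β`, `0 < Λ ≤ Λ′`, any frame `K` and `μ` with the level count `#{k⃗ : |e_K(k⃗)| < Λ′} ≤ c₁Λ′L² + c₂L`: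
`‖F_Y‖² ≤ ‖(βL²)⁻¹‖² · [(Λ′β/π + 3)·(c₁Λ′L² + c₂L)] · (2βL²/Λ)` for the symbol `p^K_{Λ,Λ′}` of `hubbardCovSliceCT_zero_seed` — uniformly in
the frame and in the Matsubara cutoff `M`. [cite: BenfattoGiulianiMastropietro2006, §2.8 (2.80)] -/
theorem norm_sq_sectorGramF_sliceCT_le [NeZero L] {N : ℕ} {β : ℝ} (hβ : 0 < β) (μ : ℝ) (K : TrigPolyC4v) {Λ Λ' c₁ c₂ : ℝ}
    (hΛ : 0 < Λ) (hΛΛ' : Λ ≤ Λ')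
    (hcount : (((univ : Finset (TorusSite 2 L)).filter fun k => |nambuXiCT L μ K k| < Λ').card : ℝ) ≤
      c₁ * Λ' * (L : ℝ) ^ 2 + c₂ * L)
    (F : Fin N → FreqMomentum L M → ℂ) (hF : ∀ ω k, ‖F ω k‖ ≤ 1) (Y : SpaceTimeIdx L M × SectorLeg N) :
    ‖sectorGramF L M β F (fun ks => ((hubbardCutoffWeightCT L M β μ K Λ ks.1 : ℂ) - (hubbardCutoffWeightCT L M β μ K Λ' ks.1 : ℂ)) *
        (((β * (L : ℝ) ^ 2 : ℝ) : ℂ) *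
          ((Complex.I * matsubaraFreq β M ks.1.1 + nambuXiCT L μ K ks.1.2) / nambuDenCT L M β μ 0 K ks.1))) Y‖ ^ 2 ≤
      ‖((1 / (β * (L : ℝ) ^ 2) : ℝ) : ℂ)‖ ^ 2 *
        (((Λ' * β / Real.pi + 3) * (c₁ * Λ' * (L : ℝ) ^ 2 + c₂ * L)) * (2 * (β * (L : ℝ) ^ 2) / Λ)) := by
  classical
  have hΛ' : 0 < Λ' := hΛ.trans_le hΛΛ'
  set T : Finset (FreqMomentum L M) := (univ : Finset (FreqMomentum L M)).filter fun k =>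
    |matsubaraFreq β M k.1| ≤ Λ' ∧ |nambuXiCT L μ K k.2| < Λ' with hT
  have h := norm_sq_sectorGramF_le (L := L) (M := M) β F
    (fun ks => ((hubbardCutoffWeightCT L M β μ K Λ ks.1 : ℂ) - (hubbardCutoffWeightCT L M β μ K Λ' ks.1 : ℂ)) *
        (((β * (L : ℝ) ^ 2 : ℝ) : ℂ) *
          ((Complex.I * matsubaraFreq β M ks.1.1 + nambuXiCT L μ K ks.1.2) / nambuDenCT L M β μ 0 K ks.1)))
    Y (S := 2 * (β * (L : ℝ) ^ 2) / Λ) (fun k => ?_) T (fun k _ hp => ?_)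
  · refine h.trans (mul_le_mul_of_nonneg_left ?_ (by positivity))
    exact mul_le_mul_of_nonneg_right (card_shellSupportCT_le hβ μ K hΛ' hcount) (by positivity)
  · -- the sup: `‖F‖² ‖p‖ ≤ 1 · 2βL²/Λ`
    have h1 : ‖F Y.2.1.1 k‖ ^ 2 ≤ 1 := by
      have := hF Y.2.1.1 k
      nlinarith [norm_nonneg (F Y.2.1.1 k)]
    calc ‖F Y.2.1.1 k‖ ^ 2 * ‖((hubbardCutoffWeightCT L M β μ K Λ (k, Y.2.1.2).1 : ℂ) -
            (hubbardCutoffWeightCT L M β μ K Λ' (k, Y.2.1.2).1 : ℂ)) *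
            (((β * (L : ℝ) ^ 2 : ℝ) : ℂ) * ((Complex.I * matsubaraFreq β M (k, Y.2.1.2).1.1 +
              nambuXiCT L μ K (k, Y.2.1.2).1.2) / nambuDenCT L M β μ 0 K (k, Y.2.1.2).1))‖
        ≤ 1 * (2 * (β * (L : ℝ) ^ 2) / Λ) :=
          mul_le_mul h1 (norm_sliceSymbolCT_le hβ μ K hΛ hΛΛ' (k, Y.2.1.2)) (norm_nonneg _) zero_le_one
      _ = 2 * (β * (L : ℝ) ^ 2) / Λ := one_mul _
  · -- the support: a nonzero symbol forces `k` into the shell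
    have hw : hubbardCutoffWeightCT L M β μ K Λ k - hubbardCutoffWeightCT L M β μ K Λ' k ≠ 0 := by
      intro h0
      apply hp
      have : ((hubbardCutoffWeightCT L M β μ K Λ k : ℂ) - (hubbardCutoffWeightCT L M β μ K Λ' k : ℂ)) = 0 := by
        exact_mod_cast h0
      simp only [this, zero_mul]
    have hw' : salmhoferCutoff ((matsubaraFreq β M k.1 ^ 2 + nambuXiCT L μ K k.2 ^ 2) / Λ ^ 2) -
        salmhoferCutoff ((matsubaraFreq β M k.1 ^ 2 + nambuXiCT L μ K k.2 ^ 2) / Λ' ^ 2) ≠ 0 := by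
      simpa only [hubbardCutoffWeightCT] using hw
    obtain ⟨-, hhi⟩ := support_sliceCutoff hΛ hΛΛ' hw'
    rw [hT, mem_filter]
    refine ⟨mem_univ _, ?_, ?_⟩
    · have : matsubaraFreq β M k.1 ^ 2 ≤ Λ' ^ 2 := by nlinarith [sq_nonneg (nambuXiCT L μ K k.2)]
      exact abs_le_of_sq_le_sq' this hΛ'.le |>.elim (fun h1 h2 => abs_le.2 ⟨h1, h2⟩)
    · have hξ : nambuXiCT L μ K k.2 ^ 2 < Λ' ^ 2 := by nlinarith [sq_nonneg (matsubaraFreq β M k.1)]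
      exact abs_lt.2 (abs_lt_of_sq_lt_sq' hξ hΛ'.le)

/-- **The Gram constant of one slice of the frame covariance (right vector), sector-free**: the same bound for `‖G_Y‖²`.
[cite: BenfattoGiulianiMastropietro2006, §2.8 (2.80)] -/
theorem norm_sq_sectorGramG_sliceCT_le [NeZero L] {N : ℕ} {β : ℝ} (hβ : 0 < β) (μ : ℝ) (K : TrigPolyC4v) {Λ Λ' c₁ c₂ : ℝ}
    (hΛ : 0 < Λ) (hΛΛ' : Λ ≤ Λ')
    (hcount : (((univ : Finset (TorusSite 2 L)).filter fun k => |nambuXiCT L μ K k| < Λ').card : ℝ) ≤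
      c₁ * Λ' * (L : ℝ) ^ 2 + c₂ * L)
    (F : Fin N → FreqMomentum L M → ℂ) (hF : ∀ ω k, ‖F ω k‖ ≤ 1) (Y' : SpaceTimeIdx L M × SectorLeg N) :
    ‖sectorGramG L M β F (fun ks => ((hubbardCutoffWeightCT L M β μ K Λ ks.1 : ℂ) - (hubbardCutoffWeightCT L M β μ K Λ' ks.1 : ℂ)) *
        (((β * (L : ℝ) ^ 2 : ℝ) : ℂ) *
          ((Complex.I * matsubaraFreq β M ks.1.1 + nambuXiCT L μ K ks.1.2) / nambuDenCT L M β μ 0 K ks.1))) Y'‖ ^ 2 ≤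
      ‖((1 / (β * (L : ℝ) ^ 2) : ℝ) : ℂ)‖ ^ 2 *
        (((Λ' * β / Real.pi + 3) * (c₁ * Λ' * (L : ℝ) ^ 2 + c₂ * L)) * (2 * (β * (L : ℝ) ^ 2) / Λ)) := by
  classical
  have hΛ' : 0 < Λ' := hΛ.trans_le hΛΛ'
  set T : Finset (FreqMomentum L M) := (univ : Finset (FreqMomentum L M)).filter fun k =>
    |matsubaraFreq β M k.1| ≤ Λ' ∧ |nambuXiCT L μ K k.2| < Λ' with hT
  have h := norm_sq_sectorGramG_le (L := L) (M := M) β F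
    (fun ks => ((hubbardCutoffWeightCT L M β μ K Λ ks.1 : ℂ) - (hubbardCutoffWeightCT L M β μ K Λ' ks.1 : ℂ)) *
        (((β * (L : ℝ) ^ 2 : ℝ) : ℂ) *
          ((Complex.I * matsubaraFreq β M ks.1.1 + nambuXiCT L μ K ks.1.2) / nambuDenCT L M β μ 0 K ks.1)))
    Y' (S := 2 * (β * (L : ℝ) ^ 2) / Λ) (fun k => ?_) T (fun k _ hp => ?_)
  · refine h.trans (mul_le_mul_of_nonneg_left ?_ (by positivity))
    exact mul_le_mul_of_nonneg_right (card_shellSupportCT_le hβ μ K hΛ' hcount) (by positivity)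
  · have h1 : ‖F Y'.2.1.1 k‖ ^ 2 ≤ 1 := by
      have := hF Y'.2.1.1 k
      nlinarith [norm_nonneg (F Y'.2.1.1 k)]
    calc ‖F Y'.2.1.1 k‖ ^ 2 * ‖((hubbardCutoffWeightCT L M β μ K Λ (k, Y'.2.1.2).1 : ℂ) -
            (hubbardCutoffWeightCT L M β μ K Λ' (k, Y'.2.1.2).1 : ℂ)) *
            (((β * (L : ℝ) ^ 2 : ℝ) : ℂ) * ((Complex.I * matsubaraFreq β M (k, Y'.2.1.2).1.1 +
              nambuXiCT L μ K (k, Y'.2.1.2).1.2) / nambuDenCT L M β μ 0 K (k, Y'.2.1.2).1))‖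
        ≤ 1 * (2 * (β * (L : ℝ) ^ 2) / Λ) :=
          mul_le_mul h1 (norm_sliceSymbolCT_le hβ μ K hΛ hΛΛ' (k, Y'.2.1.2)) (norm_nonneg _) zero_le_one
      _ = 2 * (β * (L : ℝ) ^ 2) / Λ := one_mul _
  · have hw : hubbardCutoffWeightCT L M β μ K Λ k - hubbardCutoffWeightCT L M β μ K Λ' k ≠ 0 := by
      intro h0
      apply hp
      have : ((hubbardCutoffWeightCT L M β μ K Λ k : ℂ) - (hubbardCutoffWeightCT L M β μ K Λ' k : ℂ)) = 0 := by
        exact_mod_cast h0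
      simp only [this, zero_mul]
    have hw' : salmhoferCutoff ((matsubaraFreq β M k.1 ^ 2 + nambuXiCT L μ K k.2 ^ 2) / Λ ^ 2) -
        salmhoferCutoff ((matsubaraFreq β M k.1 ^ 2 + nambuXiCT L μ K k.2 ^ 2) / Λ' ^ 2) ≠ 0 := by
      simpa only [hubbardCutoffWeightCT] using hw
    obtain ⟨-, hhi⟩ := support_sliceCutoff hΛ hΛΛ' hw'
    rw [hT, mem_filter]
    refine ⟨mem_univ _, ?_, ?_⟩
    · have : matsubaraFreq β M k.1 ^ 2 ≤ Λ' ^ 2 := by nlinarith [sq_nonneg (nambuXiCT L μ K k.2)]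
      exact abs_le_of_sq_le_sq' this hΛ'.le |>.elim (fun h1 h2 => abs_le.2 ⟨h1, h2⟩)
    · have hξ : nambuXiCT L μ K k.2 ^ 2 < Λ' ^ 2 := by nlinarith [sq_nonneg (matsubaraFreq β M k.1)]
      exact abs_lt.2 (abs_lt_of_sq_lt_sq' hξ hΛ'.le)

/-! ### The replica-Gram bound of the sectorised slice (appended) -/

/-- Two charges `a, b : Fin 2` with `[a = 0] = [b = 0]` are equal. [folklore] -/
private theorem fin_two_eq_of_decide_eq {a b : Fin 2} (h : decide (a = 0) = decide (b = 0)) : a = b := by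
  fin_cases a <;> fin_cases b <;> simp_all

/-- **The sectorised slice of the frame covariance is replica-Gram-bounded** (BGM 2006 (2.80), the literal covariance hypothesis of the
single-scale step `GrassmannEffectiveActionBoundDB.sum_norm_kernel_effAction_le_of_gramBounded`): for `0 < β`, `0 < Λ ≤ Λ′`, any frame `K`, `μ`,
every Matsubara cutoff `M ≥ 1`, multipliers `‖F_ω(k)‖ ≤ 1`, given the level count `#{k⃗ : |e_K(k⃗)| < Λ′} ≤ c₁Λ′L² + c₂L`:
`IsGramBoundedR (Sᵀ · C^K_{(Λ,Λ′]} · S) κ` with `κ² = ‖(βL²)⁻¹‖² · (Λ′β/π + 3)·(c₁Λ′L² + c₂L) · (2βL²/Λ)`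
(`S = sectorSubMatrix L M β F`; Gram form `contr = ⟪F_Y, G_{Y′}⟫` of `contr_pullback_normalCovariance_eq_inner` on the normal form
`hubbardCovSliceCT_zero_seed`, charge `q = [c = 0]`, `isGramBoundedR_of_gram`). [cite: BenfattoGiulianiMastropietro2006, §2.8 (2.80)] -/
theorem isGramBoundedR_sectorSub_sliceCT [NeZero L] [NeZero M] {N : ℕ} {β : ℝ} (hβ : 0 < β) (μ : ℝ) (K : TrigPolyC4v)
    {Λ Λ' c₁ c₂ : ℝ} (hΛ : 0 < Λ) (hΛΛ' : Λ ≤ Λ')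
    (hcount : (((univ : Finset (TorusSite 2 L)).filter fun k => |nambuXiCT L μ K k| < Λ').card : ℝ) ≤
      c₁ * Λ' * (L : ℝ) ^ 2 + c₂ * L)
    (F : Fin N → FreqMomentum L M → ℂ) (hF : ∀ ω k, ‖F ω k‖ ≤ 1) :
    IsGramBoundedR ((sectorSubMatrix L M β F).transpose * hubbardCovSliceCT L M β μ 0 K Λ Λ' * sectorSubMatrix L M β F)
      (Real.sqrt (‖((1 / (β * (L : ℝ) ^ 2) : ℝ) : ℂ)‖ ^ 2 *
        (((Λ' * β / Real.pi + 3) * (c₁ * Λ' * (L : ℝ) ^ 2 + c₂ * L)) * (2 * (β * (L : ℝ) ^ 2) / Λ)))) := by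
  set p : FreqMomentum L M × Fin 2 → ℂ := fun ks =>
    ((hubbardCutoffWeightCT L M β μ K Λ ks.1 : ℂ) - (hubbardCutoffWeightCT L M β μ K Λ' ks.1 : ℂ)) *
      (((β * (L : ℝ) ^ 2 : ℝ) : ℂ) *
        ((Complex.I * matsubaraFreq β M ks.1.1 + nambuXiCT L μ K ks.1.2) / nambuDenCT L M β μ 0 K ks.1)) with hp
  have hnormal : hubbardCovSliceCT L M β μ 0 K Λ Λ' = normalCovariance L M p := by
    rw [hp]; exact hubbardCovSliceCT_zero_seed β μ K Λ Λ'
  rw [hnormal]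
  set B : ℝ := ‖((1 / (β * (L : ℝ) ^ 2) : ℝ) : ℂ)‖ ^ 2 *
    (((Λ' * β / Real.pi + 3) * (c₁ * Λ' * (L : ℝ) ^ 2 + c₂ * L)) * (2 * (β * (L : ℝ) ^ 2) / Λ)) with hB
  refine isGramBoundedR_of_gram (fun Y : SpaceTimeIdx L M × SectorLeg N => decide (Y.2.2 = 0))
    ((sectorSubMatrix L M β F).transpose * normalCovariance L M p * sectorSubMatrix L M β F)
    (fun Y Y' h => pullback_normalCovariance_apply_of_charge_eq β F p (fin_two_eq_of_decide_eq h))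
    (sectorGramF L M β F p) (sectorGramG L M β F p) (Real.sqrt_nonneg _) (fun Y _ => ?_) (fun Y' _ => ?_)
    (fun Y Y' hY hY' => ?_)
  · rw [← Real.sqrt_sq (norm_nonneg (sectorGramF L M β F p Y))]
    exact Real.sqrt_le_sqrt (by simpa only [hp] using norm_sq_sectorGramF_sliceCT_le (L := L) (M := M) hβ μ K hΛ hΛΛ' hcount F hF Y)
  · rw [← Real.sqrt_sq (norm_nonneg (sectorGramG L M β F p Y'))]
    exact Real.sqrt_le_sqrt (by simpa only [hp] using norm_sq_sectorGramG_sliceCT_le (L := L) (M := M) hβ μ K hΛ hΛΛ' hcount F hF Y')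
  · have h0 : Y.2.2 = 0 := of_decide_eq_true hY
    have h1 : Y'.2.2 = 1 := by
      have hne : Y'.2.2 ≠ 0 := fun h => by simp [h] at hY'
      exact Fin.eq_one_of_ne_zero _ hne
    exact contr_pullback_normalCovariance_eq_inner β F p h0 h1

end Literature.MathematicalPhysics.QuantumLattice

end
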